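import Summits.Ventures.HodgeRepro2.T5LevelIdempotentAdjoint

/-!
# Adjointness of the level idempotents for an invariant pairing of two representations (p8)

For representations `ρ` on `V` and `ρ'` on `V'` of the same group and a `K`-invariant pairing
`B : V × V' → W` (`B (ρ κ v) (ρ' κ w) = B v w`, `κ ∈ K`), the two level idempotents are adjoint:
`B (e_K v) w = B v (e'_K w)` (`levelAverage_left_eq_right`), for `K`-finite `ρ`, `ρ'` in
characteristic `0`; hence a `K`-invariant vector pairs with `w` only through `e'_K w`
(`apply_eq_of_mem_invariants`).  Applied to the canonical pairing of `V` with Mathlib's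
contragredient `ρ.dual`, this gives `(e_K λ) v = λ (e_K v)` (`levelAverage_dual_apply`): the
level idempotent of the contragredient is the transpose of the level idempotent.  This is the
«⟨π(e_K) v, ṽ⟩ = ⟨v, π̃(e_K) ṽ⟩» step of the matrix-coefficient / period computations, without Haar
measure.  Nothing is asserted about any specific group.
-/

namespace Summit.Ventures.HodgeRepro2.T5LevelIdempotentPairing

open Summit.Ventures.HodgeRepro2.LevelPositivity Summit.Ventures.HodgeRepro2.T5LevelIdempotent
open Summit.Ventures.HodgeRepro2.T5LevelIdempotentAdjoint (sum_inv_quotient)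

variable {G : Type*} [Group G] {k : Type*} [Field k] {V : Type*} [AddCommGroup V] [Module k V]
  {V' : Type*} [AddCommGroup V'] [Module k V'] {W : Type*} [AddCommGroup W] [Module k W]
  (ρ : Representation k G V) (ρ' : Representation k G V') {K : Subgroup G}
  (B : V →ₗ[k] V' →ₗ[k] W) (hB : ∀ κ ∈ K, ∀ v w, B (ρ κ v) (ρ' κ w) = B v w)

include hB in
/-- Invariance moved to one side: `B (ρ κ v) w = B v (ρ' κ⁻¹ w)` for `κ ∈ K`. -/
theorem apply_left_eq_right_inv {κ : G} (hκ : κ ∈ K) (v : V) (w : V') :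
    B (ρ κ v) w = B v (ρ' κ⁻¹ w) := by
  conv_rhs => rw [← hB κ hκ]
  rw [← Module.End.mul_apply (ρ' κ) (ρ' κ⁻¹), ← map_mul, mul_inv_cancel, map_one,
    Module.End.one_apply]

include hB in
/-- The level idempotents are adjoint for an invariant pairing: `B (e_K v) w = B v (e'_K w)`
(finite-index stabilisers, characteristic `0`). -/
theorem levelAverage_left_eq_right [CharZero k] {v : V} {w : V'}
    [(stabilizerIn ρ K v).FiniteIndex] [(stabilizerIn ρ' K w).FiniteIndex] :
    B (levelAverage ρ K v) w = B v (levelAverage ρ' K w) := by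
  haveI : (stabilizerIn ρ K v ⊓ stabilizerIn ρ' K w).normalCore.Normal :=
    Subgroup.normalCore_normal _
  haveI : (stabilizerIn ρ K v ⊓ stabilizerIn ρ' K w).normalCore.FiniteIndex :=
    Subgroup.finiteIndex_normalCore _
  have hk : ((stabilizerIn ρ K v ⊓ stabilizerIn ρ' K w).normalCore.index : k) ≠ 0 :=
    Nat.cast_ne_zero.2 Subgroup.FiniteIndex.index_ne_zero
  have hNv : (stabilizerIn ρ K v ⊓ stabilizerIn ρ' K w).normalCore ≤ stabilizerIn ρ K v :=
    (Subgroup.normalCore_le _).trans inf_le_left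
  have hNw : (stabilizerIn ρ K v ⊓ stabilizerIn ρ' K w).normalCore ≤ stabilizerIn ρ' K w :=
    (Subgroup.normalCore_le _).trans inf_le_right
  letI : Fintype (K ⧸ (stabilizerIn ρ K v ⊓ stabilizerIn ρ' K w).normalCore) := Fintype.ofFinite _
  rw [levelAverage_eq hNv hk, levelAverage_eq hNw hk]
  unfold cosetSum
  rw [finsum_eq_sum_of_fintype, finsum_eq_sum_of_fintype, map_smul, LinearMap.smul_apply,
    map_smul, map_sum, LinearMap.sum_apply, map_sum]
  congr 1
  rw [← sum_inv_quotient (K := K) (N := (stabilizerIn ρ K v ⊓ stabilizerIn ρ' K w).normalCore)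
    (fun c => B v (ρ' ((Quotient.out c : K) : G) w))]
  refine Finset.sum_congr rfl (fun c _ => ?_)
  obtain ⟨κ, rfl⟩ := QuotientGroup.mk_surjective c
  rw [← QuotientGroup.mk_inv, rep_eq hNv κ, rep_eq hNw κ⁻¹, Subgroup.coe_inv]
  exact apply_left_eq_right_inv ρ ρ' B hB κ.2 v w

include hB in
/-- `B (e_K v) w = B (e_K v) (e'_K w)`. -/
theorem levelAverage_left_eq [CharZero k] (hK : KFinite ρ K) (hK' : KFinite ρ' K) (v : V)
    (w : V') : B (levelAverage ρ K v) w = B (levelAverage ρ K v) (levelAverage ρ' K w) := by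
  haveI := hK (levelAverage ρ K v)
  haveI := hK v
  haveI := hK' w
  rw [← levelAverage_left_eq_right ρ ρ' B hB, levelAverage_levelAverage]

include hB in
/-- A `K`-invariant vector pairs with `w` as with `e'_K w`. -/
theorem apply_eq_of_mem_invariants [CharZero k] (hK : KFinite ρ K) (hK' : KFinite ρ' K)
    {v : V} (hv : v ∈ invariants ρ K) (w : V') : B v w = B v (levelAverage ρ' K w) := by
  haveI := hK v
  haveI := hK' w
  rw [← levelAverage_left_eq_right ρ ρ' B hB, levelAverage_of_mem_invariants hv]

include hB in
/-- A `K`-invariant vector annihilates `V'(K)`: `B v (w − e'_K w) = 0`. -/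
theorem apply_sub_levelAverage_eq_zero [CharZero k] (hK : KFinite ρ K) (hK' : KFinite ρ' K)
    {v : V} (hv : v ∈ invariants ρ K) (w : V') : B v (w - levelAverage ρ' K w) = 0 := by
  rw [map_sub, ← apply_eq_of_mem_invariants ρ ρ' B hB hK hK' hv, sub_self]

section Dual

/-- The canonical pairing `V × V^∨ → k` is `K`-invariant for `ρ` and the contragredient. -/
theorem dual_pairing_invariant (κ : G) (v : V) (l : Module.Dual k V) :
    (ρ.dual κ l) (ρ κ v) = l v := by
  rw [Representation.dual_apply, Module.Dual.transpose_apply, LinearMap.comp_apply,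
    ← Module.End.mul_apply, ← map_mul, inv_mul_cancel, map_one, Module.End.one_apply]

/-- The level idempotent of the contragredient is the transpose of the level idempotent:
`(e_K λ) v = λ (e_K v)` (`K`-finite `ρ` and `ρ.dual`, characteristic `0`). -/
theorem levelAverage_dual_apply [CharZero k] (hK : KFinite ρ K) (hK' : KFinite ρ.dual K)
    (l : Module.Dual k V) (v : V) :
    (levelAverage ρ.dual K l) v = l (levelAverage ρ K v) := by
  haveI := hK v
  haveI := hK' l
  have h := levelAverage_left_eq_right (K := K) ρ ρ.dual
    ((LinearMap.id : Module.Dual k V →ₗ[k] Module.Dual k V).flip)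
    (fun κ _ v l => by
      simp only [LinearMap.flip_apply, LinearMap.id_apply]
      exact dual_pairing_invariant ρ κ v l) (v := v) (w := l)
  simpa only [LinearMap.flip_apply, LinearMap.id_apply] using h.symm

end Dual

end Summit.Ventures.HodgeRepro2.T5LevelIdempotentPairing
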